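import Mathlib
import HarnessLib
import Literature.MathematicalPhysics.KineticTheory.HardSphereEulerProofs
import Summits.AtomisticToContinuum.HydrodynamicLimit.Theses.OneFlightGossipEngine
import Summits.AtomisticToContinuum.HydrodynamicLimit.Theses.TwoClocks
import Summits.AtomisticToContinuum.HydrodynamicLimit.Theorems.ImplosionDichotomyHydroLimitInBandOfHeart
import Summits.AtomisticToContinuum.HydrodynamicLimit.Theorems.OneFlightGossipEngineKineticCurrentsLDAlongFamiliesKCWUSharpPlus

/-!
# One statement for four targets: `KWLDUSharp` — crux `KineticCurrentsLDAlongFamilies`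
# (stmt-AtomisticToContinuum-16659), line `Sketch`, lead prover-line-…-16659-c4-0 (lead cycle 5)

Route `OneFlightGossipEngine`, sub-problem `HydrodynamicLimit`. A cross-route DEDUP certificate for the planner
(all sorry-free; the hypothesis is written UNFOLDED, no new definition, and is NOT claimed).

`KWLDUSharp` := the pointwise kinetic-window LD rung for the GENERAL continuous class (every continuous
`F : 𝕋³ × ℝ³ → ℝ` of growth `C(1+‖v‖²)` orthogonal to `1, v_j, ‖v‖²` under `M_{1,u₀(x),θ₀(x)}` at every `x` —
the class of route TwoClocks' pointwise node `TwoClocks.KineticWindowLDUniform`, stmt-14442) with the two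
sharpenings every consumer needs: a NUMERIC tilt threshold `β₀ = β₀(Θ,U,C,Λ,σ)` chosen before the profiles,
the flows and the weight, and the eventual window shape `∃ τ₀ ∀ τ ≥ τ₀ ∃ N₀`.

* `kcwuSharpPlus_of_kwlduSharp` — it contains this line's single open stub `KCWUSharpPlus` (the structured
  class `A(x):w⊗w + (b(x)·w)G(x,|w|²) + K(x,|w|²)` is continuous, so it is an instance);
* `kwlduSharp_closes_four` — hence, at once: the crux stmt-16659 (through the landed
  `stub_kcwuSharpPlus_implies_crux`, p137412); the heart's kinetic family node
  `HydroLimitInBandOfHeart.KineticCurrentsWindowLDFamily` (the consequent of TwoClocks' open stub S3b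
  `KineticFamilyOfEquilibrium` on stmt-16625 and an input of the ImplosionDichotomy heart; the crux up to
  `Iff.rfl`); this route's support rung stmt-14662 (p137412 ∘ p134390); and TwoClocks' pointwise node
  stmt-14442 `TwoClocks.KineticWindowLDUniform` (bounds of one continuous positive profile triple by
  compactness of `𝕋³`; window `τ := τ₀`).

So promoting `KWLDUSharp` (or, for this route alone, `KCWUSharpPlus`) files ONE statement for 16659, 14662,
14442 and TwoClocks' S3b. It is research-level (kinetic relaxation of the non-hydrodynamic one-body modes at
LD scale over `τ ≫ 1` mean free times for deterministic hard spheres at fixed reduced density; no print).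
-/

noncomputable section

open MeasureTheory Set Filter
open scoped ENNReal Topology

namespace Summit.AtomisticToContinuum.HydrodynamicLimit.Theorems.KineticCurrentsLDAlongFamiliesSketch

open Literature.Analysis.FluidPDE (HardSphereFlow Config localMaxwellian)
open Literature.MathematicalPhysics.KineticTheory (T3 V3 hsDiameter localGibbsLaw)
open Literature.Analysis.FluidPDE Literature.MathematicalPhysics.KineticTheory
open Summit.AtomisticToContinuum.HydrodynamicLimit.Theses.OneFlightGossipEngine
  (KineticCurrentsLDAlongFamilies KineticCurrentsWindowLDUniform)
open Summit.AtomisticToContinuum.HydrodynamicLimit.Theses (TwoClocks.KineticWindowLDUniform)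
open Summit.AtomisticToContinuum.HydrodynamicLimit.Theorems.HydroLimitInBandOfHeart (KineticCurrentsWindowLDFamily)

/-- The structured class functional `A(x):w⊗w + (b(x)·w)G(x,|w|²) + K(x,|w|²)`, `w = v − u₀(x)`, is
continuous when its weights and the velocity profile are. [folklore] -/
theorem continuous_plusClassFunctional {u₀ : T3 → V3} (hu : Continuous u₀)
    {A : T3 → Fin 3 → Fin 3 → ℝ} {b : T3 → V3} {G K : T3 × ℝ → ℝ}
    (hA : Continuous A) (hb : Continuous b) (hG : Continuous G) (hK : Continuous K)
    {F : T3 × V3 → ℝ} (hF : ∀ y, F y =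
      (∑ j : Fin 3, ∑ k : Fin 3, A y.1 j k * ((y.2 - u₀ y.1) j * (y.2 - u₀ y.1) k)) +
        (∑ j : Fin 3, b y.1 j * (y.2 - u₀ y.1) j) * G (y.1, ‖y.2 - u₀ y.1‖ ^ 2) +
        K (y.1, ‖y.2 - u₀ y.1‖ ^ 2)) :
    Continuous F := by
  have hrw : F = fun y : T3 × V3 =>
      (∑ j : Fin 3, ∑ k : Fin 3, A y.1 j k * ((y.2 - u₀ y.1) j * (y.2 - u₀ y.1) k)) +
        (∑ j : Fin 3, b y.1 j * (y.2 - u₀ y.1) j) * G (y.1, ‖y.2 - u₀ y.1‖ ^ 2) +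
        K (y.1, ‖y.2 - u₀ y.1‖ ^ 2) := funext hF
  rw [hrw]
  have hw : Continuous fun y : T3 × V3 => y.2 - u₀ y.1 := continuous_snd.sub (hu.comp continuous_fst)
  have hcoord : ∀ j : Fin 3, Continuous fun y : T3 × V3 => (y.2 - u₀ y.1) j :=
    fun j => (EuclideanSpace.proj j).continuous.comp hw
  have hAjk : ∀ j k : Fin 3, Continuous fun y : T3 × V3 => A y.1 j k := fun j k =>
    ((continuous_apply k).comp ((continuous_apply j).comp hA)).comp continuous_fst
  have hbj : ∀ j : Fin 3, Continuous fun y : T3 × V3 => b y.1 j := fun j =>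
    (EuclideanSpace.proj j).continuous.comp (hb.comp continuous_fst)
  have hρ : Continuous fun y : T3 × V3 => (y.1, ‖y.2 - u₀ y.1‖ ^ 2) :=
    continuous_fst.prodMk ((hw.norm).pow 2)
  have hGc : Continuous fun y : T3 × V3 => G (y.1, ‖y.2 - u₀ y.1‖ ^ 2) := hG.comp hρ
  have hKc : Continuous fun y : T3 × V3 => K (y.1, ‖y.2 - u₀ y.1‖ ^ 2) := hK.comp hρ
  refine Continuous.add (Continuous.add ?_ ?_) hKc
  · exact continuous_finsetSum _ fun j _ => continuous_finsetSum _ fun k _ =>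
      (hAjk j k).mul ((hcoord j).mul (hcoord k))
  · exact (continuous_finsetSum _ fun j _ => (hbj j).mul (hcoord j)).mul hGc

/-- **`KWLDUSharp ⟹ KCWUSharpPlus`**: the single open stub of line `Sketch` (v6) is the instance of the
general-class numeric-threshold rung at the (continuous) structured class functional. [folklore] -/
theorem kcwuSharpPlus_of_kwlduSharp :
    (∃ η₀ : ℝ, 0 < η₀ ∧ ∀ (Θ U C Λ : ℝ), 1 ≤ Θ → 0 ≤ U → 0 ≤ C → 1 ≤ Λ → ∀ σ : ℝ, 0 < σ →
      ∃ β₀ : ℝ, 0 < β₀ ∧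
      ∀ (a θ₀ : T3 → ℝ) (u₀ : T3 → V3), Continuous a → Continuous θ₀ → Continuous u₀ →
      (∀ x, Λ⁻¹ ≤ a x ∧ a x ≤ Λ) → (∀ x, Θ⁻¹ ≤ θ₀ x ∧ θ₀ x ≤ Θ) → (∀ x, ‖u₀ x‖ ≤ U) →
      σ ^ 3 * (⨆ x, a x) ≤ η₀ * ∫ x, a x →
      ∀ Φ : (N : ℕ) → HardSphereFlow (Torus.geometry (Fin 3)) (hsDiameter σ N) (N + 1),
      ∀ F : T3 × V3 → ℝ, Continuous F →
      (∀ y, |F y| ≤ C * (1 + ‖y.2‖ ^ 2)) →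
      (∀ x, ∫ v, F (x, v) * localMaxwellian 1 (θ₀ x) (u₀ x) v = 0) →
      (∀ x (j : Fin 3), ∫ v, F (x, v) * v j * localMaxwellian 1 (θ₀ x) (u₀ x) v = 0) →
      (∀ x, ∫ v, F (x, v) * ‖v‖ ^ 2 * localMaxwellian 1 (θ₀ x) (u₀ x) v = 0) →
      ∀ β : ℝ, |β| ≤ β₀ → ∀ ε : ℝ, 0 < ε → ∃ τ₀ : ℝ, 0 < τ₀ ∧ ∀ τ : ℝ, τ₀ ≤ τ →
      ∃ N₀ : ℕ, ∀ N : ℕ, N₀ ≤ N →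
      ∫⁻ z, ENNReal.ofReal (Real.exp (β * ∑ i : Fin (N + 1),
      (τ * ((N : ℝ) + 1) ^ (-(1 / 3 : ℝ)))⁻¹ *
      ∫ r in (0 : ℝ)..(τ * ((N : ℝ) + 1) ^ (-(1 / 3 : ℝ))), F (((Φ N).flow r z) i)))
      ∂(localGibbsLaw σ a u₀ θ₀ N (Φ N)) ≤
      ENNReal.ofReal (Real.exp (ε * ((N : ℝ) + 1)))) →
    (∃ η₀ : ℝ, 0 < η₀ ∧ ∀ (Θ U C Λ : ℝ), 1 ≤ Θ → 0 ≤ U → 0 ≤ C → 1 ≤ Λ → ∀ σ : ℝ, 0 < σ →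
      ∃ β₀ : ℝ, 0 < β₀ ∧
      ∀ (a θ₀ : T3 → ℝ) (u₀ : T3 → V3), Continuous a → Continuous θ₀ → Continuous u₀ →
      (∀ x, Λ⁻¹ ≤ a x ∧ a x ≤ Λ) → (∀ x, Θ⁻¹ ≤ θ₀ x ∧ θ₀ x ≤ Θ) → (∀ x, ‖u₀ x‖ ≤ U) →
      σ ^ 3 * (⨆ x, a x) ≤ η₀ * ∫ x, a x →
      ∀ Φ : (N : ℕ) → HardSphereFlow (Torus.geometry (Fin 3)) (hsDiameter σ N) (N + 1),
      ∀ (A : T3 → Fin 3 → Fin 3 → ℝ) (b : T3 → V3) (G K : T3 × ℝ → ℝ),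
      Continuous A → Continuous b → Continuous G → Continuous K →
      ∀ F : T3 × V3 → ℝ, (∀ y, F y =
      (∑ j : Fin 3, ∑ k : Fin 3, A y.1 j k * ((y.2 - u₀ y.1) j * (y.2 - u₀ y.1) k)) +
      (∑ j : Fin 3, b y.1 j * (y.2 - u₀ y.1) j) * G (y.1, ‖y.2 - u₀ y.1‖ ^ 2) +
      K (y.1, ‖y.2 - u₀ y.1‖ ^ 2)) →
      (∀ y, |F y| ≤ C * (1 + ‖y.2‖ ^ 2)) →
      (∀ x, ∫ v, F (x, v) * localMaxwellian 1 (θ₀ x) (u₀ x) v = 0) →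
      (∀ x (j : Fin 3), ∫ v, F (x, v) * v j * localMaxwellian 1 (θ₀ x) (u₀ x) v = 0) →
      (∀ x, ∫ v, F (x, v) * ‖v‖ ^ 2 * localMaxwellian 1 (θ₀ x) (u₀ x) v = 0) →
      ∀ β : ℝ, |β| ≤ β₀ → ∀ ε : ℝ, 0 < ε → ∃ τ₀ : ℝ, 0 < τ₀ ∧ ∀ τ : ℝ, τ₀ ≤ τ →
      ∃ N₀ : ℕ, ∀ N : ℕ, N₀ ≤ N →
      ∫⁻ z, ENNReal.ofReal (Real.exp (β * ∑ i : Fin (N + 1),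
      (τ * ((N : ℝ) + 1) ^ (-(1 / 3 : ℝ)))⁻¹ *
      ∫ r in (0 : ℝ)..(τ * ((N : ℝ) + 1) ^ (-(1 / 3 : ℝ))), F (((Φ N).flow r z) i)))
      ∂(localGibbsLaw σ a u₀ θ₀ N (Φ N)) ≤
      ENNReal.ofReal (Real.exp (ε * ((N : ℝ) + 1)))) := by
  rintro ⟨η₀, hη₀, h⟩
  refine ⟨η₀, hη₀, fun Θ U C Λ hΘ hU hC hΛ σ hσ => ?_⟩
  obtain ⟨β₀, hβ₀, hmain⟩ := h Θ U C Λ hΘ hU hC hΛ σ hσ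
  refine ⟨β₀, hβ₀, ?_⟩
  intro a θ₀ u₀ ha hθ hu haB hθB huB hguard Φ A b G K hA hb hG hK F hF hFC h1 hv hE β hβ ε hε
  exact hmain a θ₀ u₀ ha hθ hu haB hθB huB hguard Φ F (continuous_plusClassFunctional hu hA hb hG hK hF)
    hFC h1 hv hE β hβ ε hε

/-- **`KWLDUSharp` closes four targets at once**: crux stmt-16659 `KineticCurrentsLDAlongFamilies` (through the
landed certificate `stub_kcwuSharpPlus_implies_crux`, p137412); the heart's kinetic family node
`HydroLimitInBandOfHeart.KineticCurrentsWindowLDFamily` (the consequent of TwoClocks' open stub S3b on stmt-16625 and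
an input of the ImplosionDichotomy heart; it is the crux up to `Iff.rfl`); this route's support rung stmt-14662
`KineticCurrentsWindowLDUniform` (through `kineticCurrentsWindowLDUniform_of_kcwuSharpPlus`, p137412 ∘ p134390);
and TwoClocks' pointwise node stmt-14442 `TwoClocks.KineticWindowLDUniform` (one continuous positive profile triple
is bounded two-sidedly by compactness of `𝕋³`, the growth constant may be taken non-negative, window `τ := τ₀`).
[folklore] -/
theorem kwlduSharp_closes_four :
    (∃ η₀ : ℝ, 0 < η₀ ∧ ∀ (Θ U C Λ : ℝ), 1 ≤ Θ → 0 ≤ U → 0 ≤ C → 1 ≤ Λ → ∀ σ : ℝ, 0 < σ →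
      ∃ β₀ : ℝ, 0 < β₀ ∧
      ∀ (a θ₀ : T3 → ℝ) (u₀ : T3 → V3), Continuous a → Continuous θ₀ → Continuous u₀ →
      (∀ x, Λ⁻¹ ≤ a x ∧ a x ≤ Λ) → (∀ x, Θ⁻¹ ≤ θ₀ x ∧ θ₀ x ≤ Θ) → (∀ x, ‖u₀ x‖ ≤ U) →
      σ ^ 3 * (⨆ x, a x) ≤ η₀ * ∫ x, a x →
      ∀ Φ : (N : ℕ) → HardSphereFlow (Torus.geometry (Fin 3)) (hsDiameter σ N) (N + 1),
      ∀ F : T3 × V3 → ℝ, Continuous F →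
      (∀ y, |F y| ≤ C * (1 + ‖y.2‖ ^ 2)) →
      (∀ x, ∫ v, F (x, v) * localMaxwellian 1 (θ₀ x) (u₀ x) v = 0) →
      (∀ x (j : Fin 3), ∫ v, F (x, v) * v j * localMaxwellian 1 (θ₀ x) (u₀ x) v = 0) →
      (∀ x, ∫ v, F (x, v) * ‖v‖ ^ 2 * localMaxwellian 1 (θ₀ x) (u₀ x) v = 0) →
      ∀ β : ℝ, |β| ≤ β₀ → ∀ ε : ℝ, 0 < ε → ∃ τ₀ : ℝ, 0 < τ₀ ∧ ∀ τ : ℝ, τ₀ ≤ τ →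
      ∃ N₀ : ℕ, ∀ N : ℕ, N₀ ≤ N →
      ∫⁻ z, ENNReal.ofReal (Real.exp (β * ∑ i : Fin (N + 1),
      (τ * ((N : ℝ) + 1) ^ (-(1 / 3 : ℝ)))⁻¹ *
      ∫ r in (0 : ℝ)..(τ * ((N : ℝ) + 1) ^ (-(1 / 3 : ℝ))), F (((Φ N).flow r z) i)))
      ∂(localGibbsLaw σ a u₀ θ₀ N (Φ N)) ≤
      ENNReal.ofReal (Real.exp (ε * ((N : ℝ) + 1)))) →
    KineticCurrentsLDAlongFamilies ∧ KineticCurrentsWindowLDFamily ∧ KineticCurrentsWindowLDUniform ∧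
      TwoClocks.KineticWindowLDUniform := by
  intro hKW
  have hcrux : KineticCurrentsLDAlongFamilies := stub_kcwuSharpPlus_implies_crux (kcwuSharpPlus_of_kwlduSharp hKW)
  have hfam : KineticCurrentsWindowLDFamily :=
    (show KineticCurrentsWindowLDFamily ↔ KineticCurrentsLDAlongFamilies from Iff.rfl).2 hcrux
  have hrung : KineticCurrentsWindowLDUniform :=
    kineticCurrentsWindowLDUniform_of_kcwuSharpPlus (kcwuSharpPlus_of_kwlduSharp hKW)
  refine ⟨hcrux, hfam, hrung, ?_⟩
  obtain ⟨η₀, hη₀, hS⟩ := hKW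
  refine ⟨η₀, hη₀, ?_⟩
  intro a θ₀ u₀ ha hθ hu ha0 hθ0 σ hσ hguard Φ F hFc hC h1 hv hE
  obtain ⟨C, hC⟩ := hC
  have hC0 : 0 ≤ C := growthConst_nonneg hC
  obtain ⟨Θ, hΘ1, hΘ⟩ := exists_two_sided_bound_of_continuous_pos 0 (fun _ x => θ₀ x)
    (show Continuous fun p : ℝ × T3 => θ₀ p.2 from hθ.comp continuous_snd) (fun _ x => hθ0 x)
  obtain ⟨Λ, hΛ1, hΛ⟩ := exists_two_sided_bound_of_continuous_pos 0 (fun _ x => a x)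
    (show Continuous fun p : ℝ × T3 => a p.2 from ha.comp continuous_snd) (fun _ x => ha0 x)
  obtain ⟨U, hU0, hU⟩ := exists_norm_bound_of_continuous 0 (fun _ x => u₀ x)
    (show Continuous fun p : ℝ × T3 => u₀ p.2 from hu.comp continuous_snd)
  have h0 : (0 : ℝ) ∈ Icc (0 : ℝ) 0 := ⟨le_rfl, le_rfl⟩
  obtain ⟨β₀, hβ₀, hmain⟩ := hS Θ U C Λ hΘ1 hU0 hC0 hΛ1 σ hσ
  refine ⟨β₀, hβ₀, fun β hβ ε hε => ?_⟩
  obtain ⟨τ₀, hτ₀, hτ⟩ := hmain a θ₀ u₀ ha hθ hu (fun x => hΛ 0 h0 x) (fun x => hΘ 0 h0 x)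
    (fun x => hU 0 h0 x) hguard Φ F hFc hC h1 hv hE β hβ ε hε
  obtain ⟨N₀, hN₀⟩ := hτ τ₀ le_rfl
  exact ⟨τ₀, hτ₀, N₀, hN₀⟩

end Summit.AtomisticToContinuum.HydrodynamicLimit.Theorems.KineticCurrentsLDAlongFamiliesSketch

end
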